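import Literature.Probability.RandomPlanarGeometry.SLETransienceKappaLtFour
import Literature.Probability.RandomPlanarGeometry.SLETraceApproximation
import HarnessLib

/-!
# The shifted SLE trace exists given the trace; transience of SLE_κ, `0 < κ < 4`, from `HasSLETrace κ` alone

Trunk T-STOCH; theorems only (no new named fact). Rohde–Schramm, *Basic properties of SLE*,
Ann. of Math. 161 (2005), proof of Thm. 7.1 (p. 911) uses the conformal Markov property of the
SLE trace at time `1`: "`g₁(γ[1, ∞))` has the same distribution as `γ[0, ∞)` translated by
`ξ(1)`". In this tree that input is the hypothesis `hs` of `SLETransienceSimple` /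
`SLETransienceKappaLtFour` / `SLETraceMarkov`: *almost surely the Loewner chain of the increments
`u ↦ W(s + u) - W(s)` of the driving function `W = √κ B` is generated by a curve*, so far supplied
only from Rohde–Schramm's Cor. 3.5 (`ae_exists_isGeneratedByCurve_shift_of_cor35`; the module
docstring of `SLETraceShift` records that `HasSLETrace κ` "cannot be transported to it by a law
argument (the event 'the chain is generated by a curve' is not known to be measurable)").

Since `SLETraceApproximation` that event IS known to be Borel on the driving-path space
`C([0, ∞), ℝ)` (`measurableSet_snd_image_generatedPairs`: the injective projection of the closed
set `generatedPairs`, Lusin–Souslin), so the law argument goes through, and we PROVE: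

* `ae_exists_isGeneratedByCurve_shift_of_hasSLETrace` — if SLE_κ is a.s. generated by a curve,
  then for every `s ≥ 0` so is, a.s., the chain of `u ↦ W(s + u) - W(s)` (weak Markov property of
  Brownian motion, `identDistrib_sleDriving_shift`, read on `C([0, ∞), ℝ)` through
  `Process.measure_continuousMap_ext_of_fdd`);
* `identDistrib_trace_shift_of_hasSLETrace` — hence the shifted trace has the law of the trace,
  from `HasSLETrace κ` alone (`identDistrib_trace_shift`);
* `tendsto_norm_sleTrace_atTop_of_hasSLETrace_of_lt_four` — **Rohde–Schramm's Thm. 7.1 for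
  `0 < κ < 4` from `HasSLETrace κ` alone**: a.s. `|γ(t)| → ∞`
  (`tendsto_norm_sleTrace_atTop_of_lt_four`, whose only other hypothesis was `hs`);
* `tendsto_norm_sleTrace_atTop_eightThirds_of_hasSLETrace` — the case `κ = 8/3` used by the
  conformal restriction files ([LSW] Thm. 6.1 needs the transience of the SLE_{8/3} trace).

## References

* S. Rohde, O. Schramm, *Basic properties of SLE*, Ann. of Math. 161 (2005): Prop. 2.1 (ii),
  Thm. 7.1 and its proof (p. 911).
* G. F. Lawler, *Conformally Invariant Processes in the Plane*, AMS (2005), §6.2 p. 148 (the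
  curves `γˢ` "have the same distribution as `γ`").
* A. S. Kechris, *Classical Descriptive Set Theory* (1995), Thm. 15.1 (Lusin–Souslin).
-/

noncomputable section

open Set Filter Topology MeasureTheory ProbabilityTheory
open scoped NNReal

namespace Literature.Probability.RandomPlanarGeometry

open scoped PathBorel

variable {κ : ℝ≥0}

/-- **The chain of the increments of the SLE_κ driving function after time `s` is a.s.
generated by a curve, whenever SLE_κ is** (every `κ`, every `s ≥ 0`). The driving path
`W = √κ B` and its increment path `u ↦ W(s + u) - W(s)` have the same law on `C([0, ∞), ℝ)`
(`identDistrib_sleDriving_shift`, an identity of all finite-dimensional laws, determines the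
Borel laws: `Process.measure_continuousMap_ext_of_fdd`), and the set of continuous driving
functions generated by a curve is Borel (`measurableSet_snd_image_generatedPairs`), so it has
full measure for one law iff for the other. Rohde–Schramm (2005), Prop. 2.1 (ii) and §7 p. 911;
Lawler (2005), §6.2. [cite: RohdeSchramm2005, Prop. 2.1 and proof of Thm 7.1 (p. 911)] -/
theorem ae_exists_isGeneratedByCurve_shift_of_hasSLETrace (h0 : HasSLETrace κ) (s : ℝ≥0) :
    ∀ᵐ ω ∂Process.preWienerMeasure,
      ∃ γ, Loewner.IsGeneratedByCurve (fun u ↦ sleDriving κ ω (s + u) - sleDriving κ ω s) γ := by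
  haveI : IsProbabilityMeasure Process.preWienerMeasure := isProbabilityMeasure_preWienerMeasure'
  -- the two random elements of `C([0, ∞), ℝ)`
  have hYc : ∀ ω : ℝ≥0 → ℝ, Continuous fun u ↦ sleDriving κ ω (s + u) - sleDriving κ ω s :=
    fun ω ↦ ((continuous_sleDriving κ ω).comp (continuous_const.add continuous_id)).sub
      continuous_const
  set Y : (ℝ≥0 → ℝ) → C(ℝ≥0, ℝ) :=
    fun ω ↦ ⟨fun u ↦ sleDriving κ ω (s + u) - sleDriving κ ω s, hYc ω⟩ with hYdef
  have hXm : Measurable (drivingPath κ) := measurable_drivingPath κ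
  have hYm : Measurable Y :=
    Process.measurable_continuousMap_of_eval fun u ↦
      (measurable_sleDriving κ _).sub (measurable_sleDriving κ _)
  -- they have the same law on path space
  have hlaw : Process.preWienerMeasure.map Y = Process.preWienerMeasure.map (drivingPath κ) := by
    haveI : IsFiniteMeasure (Process.preWienerMeasure.map Y) :=
      Measure.isFiniteMeasure_map _ _
    refine Process.measure_continuousMap_ext_of_fdd fun I ↦ ?_
    have hr : Measurable fun (f : C(ℝ≥0, ℝ)) (i : I) ↦ f i :=
      measurable_pi_lambda _ fun i ↦ (measurable_pi_apply (i : ℝ≥0)).comp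
        Process.measurable_coeFn_continuousMap
    rw [Measure.map_map hr hYm, Measure.map_map hr hXm]
    have hid := ((identDistrib_sleDriving_shift (κ := κ) s).comp
      (Finset.measurable_restrict (X := fun _ : ℝ≥0 ↦ ℝ) I)).map_eq
    exact hid.symm
  -- the Borel set of driving paths generated by a curve has full measure for both laws
  have hG : MeasurableSet (Prod.snd '' generatedPairs) := measurableSet_snd_image_generatedPairs
  have hXG : ∀ᵐ ω ∂Process.preWienerMeasure, drivingPath κ ω ∈ Prod.snd '' generatedPairs := by
    filter_upwards [h0] with ω ⟨γ, hγ⟩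
    exact ⟨(⟨γ, hγ.continuous⟩, drivingPath κ ω), hγ, rfl⟩
  have h1 : Process.preWienerMeasure.map (drivingPath κ) (Prod.snd '' generatedPairs)ᶜ = 0 := by
    rw [Measure.map_apply hXm hG.compl]
    refine measure_eq_zero_iff_ae_notMem.2 ?_
    filter_upwards [hXG] with ω hω
    simpa using hω
  have h2 : ∀ᵐ ω ∂Process.preWienerMeasure, Y ω ∈ Prod.snd '' generatedPairs := by
    have h : Process.preWienerMeasure (Y ⁻¹' (Prod.snd '' generatedPairs)ᶜ) = 0 := by
      rw [← Measure.map_apply hYm hG.compl, hlaw, h1]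
    filter_upwards [measure_eq_zero_iff_ae_notMem.1 h] with ω hω
    simpa using hω
  filter_upwards [h2] with ω ⟨⟨γ, W⟩, hp, hW⟩
  have hW' : (W : ℝ≥0 → ℝ) = fun u ↦ sleDriving κ ω (s + u) - sleDriving κ ω s := by
    rw [show W = Y ω from hW]
    rfl
  have hp' : Loewner.IsGeneratedByCurve (W : ℝ≥0 → ℝ) γ := hp
  rw [hW'] at hp'
  exact ⟨γ, hp'⟩

/-- **The shifted trace has the law of the trace, from `HasSLETrace κ` alone**: for every
`s ≥ 0`, the trace of `u ↦ W(s + u) - W(s)` has the law of `sleTrace κ` on the path space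
(`identDistrib_trace_shift` with its hypothesis `hs` discharged by
`ae_exists_isGeneratedByCurve_shift_of_hasSLETrace`). Rohde–Schramm (2005), Prop. 2.1 (ii) and
p. 911; Lawler (2005), §6.2. [cite: RohdeSchramm2005, Prop. 2.1] -/
theorem identDistrib_trace_shift_of_hasSLETrace (h0 : HasSLETrace κ) (s : ℝ≥0) :
    IdentDistrib (fun ω ↦ Loewner.trace (fun u ↦ sleDriving κ ω (s + u) - sleDriving κ ω s))
      (fun ω ↦ sleTrace κ ω) Process.preWienerMeasure Process.preWienerMeasure :=
  identDistrib_trace_shift h0 (ae_exists_isGeneratedByCurve_shift_of_hasSLETrace h0 s)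

/-- **`0 ∉ cl γ[1, ∞)` a.s. for SLE_κ, `0 < κ < 4`, from `HasSLETrace κ` alone**
(`ae_zero_notMem_closure_sleTrace_image_Ici_of_lt_four` with the shifted trace supplied by
`ae_exists_isGeneratedByCurve_shift_of_hasSLETrace`). Rohde–Schramm (2005), proof of Thm. 7.1,
p. 911. [cite: RohdeSchramm2005, proof of Thm 7.1 (p. 911)] -/
theorem ae_zero_notMem_closure_sleTrace_image_Ici_of_hasSLETrace_of_lt_four (hκ0 : 0 < κ)
    (hκ : κ < 4) (h0 : HasSLETrace κ) :
    ∀ᵐ ω ∂Process.preWienerMeasure, (0 : ℂ) ∉ closure (sleTrace κ ω '' Ici 1) :=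
  ae_zero_notMem_closure_sleTrace_image_Ici_of_lt_four hκ0 hκ h0
    (ae_exists_isGeneratedByCurve_shift_of_hasSLETrace h0 1)

/-- **Transience of the SLE_κ trace, `0 < κ < 4`, from `HasSLETrace κ` alone** (Rohde–Schramm
(2005), Thm. 7.1 in this range): if SLE_κ is a.s. generated by a curve then almost surely
`|γ(t)| → ∞` as `t → ∞`. This is `tendsto_norm_sleTrace_atTop_of_lt_four`, whose remaining
hypothesis — the a.s. existence of the shifted trace after time `1` — is now a consequence of
`HasSLETrace κ` (`ae_exists_isGeneratedByCurve_shift_of_hasSLETrace`); Lemma 7.2 (simultaneous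
form, `κ < 4`), the simplicity of the trace for `κ ≤ 4`, scale invariance and the Markov property
are theorems of the tree. [cite: RohdeSchramm2005, Thm 7.1] -/
theorem tendsto_norm_sleTrace_atTop_of_hasSLETrace_of_lt_four (hκ0 : 0 < κ) (hκ : κ < 4)
    (h0 : HasSLETrace κ) :
    ∀ᵐ ω ∂Process.preWienerMeasure, Tendsto (fun t ↦ ‖sleTrace κ ω t‖) atTop atTop :=
  tendsto_norm_sleTrace_atTop_of_lt_four hκ0 hκ h0
    (ae_exists_isGeneratedByCurve_shift_of_hasSLETrace h0 1)

/-- **Transience of the SLE_{8/3} trace from `HasSLETrace (8/3)`** — the instance of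
`tendsto_norm_sleTrace_atTop_of_hasSLETrace_of_lt_four` used by the conformal restriction files
([LSW] Thm. 6.1 for SLE_{8/3}). [cite: RohdeSchramm2005, Thm 7.1] -/
theorem tendsto_norm_sleTrace_atTop_eightThirds_of_hasSLETrace (hgen : HasSLETrace ((8 : ℝ≥0) / 3)) :
    ∀ᵐ ω ∂Process.preWienerMeasure,
      Tendsto (fun t ↦ ‖sleTrace ((8 : ℝ≥0) / 3) ω t‖) atTop atTop := by
  refine tendsto_norm_sleTrace_atTop_of_hasSLETrace_of_lt_four (by positivity) ?_ hgen
  rw [div_lt_iff₀ (by norm_num : (0 : ℝ≥0) < 3)]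
  norm_num

end Literature.Probability.RandomPlanarGeometry

end
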